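import Literature.AnabelianGeometry.AbsoluteAnabelian.AbsTopIII.Thm19KummerContainerLemmas
import HarnessLib

/-!
# [AbsTopIII] Thm. 1.9 (d): the parts "`K_{Z_NF}^×`", "`k̄_NF^×`" of the Kummer container cut out by
# Prop. 1.8 (i), (ii) — discharge of the set halves of `Thm19d_functionField` / `Thm19d_constants`

Mochizuki, *Topics in Absolute Anabelian Geometry III*, §1, Theorem 1.9 (d), manuscript pp. 37–38
(lit key `paper:url-5493eb38cbb7`): "one constructs the subgroups
`k̄_NF^× ⊆ K_{Z_NF}^× ↪ lim_{→V} H¹(Π_V, μ_Ẑ(Π_U))` [...] — via the subgroups of (c) and the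
characterizations of Kummer classes of nonconstant NF-rational functions and NF-constants given in
Proposition 1.8, (i), (ii)".

Proof-only companion of `Thm19KummerContainer.lean` (abc-iut-w5-d213, p414838; sub-DAG
`plan/L4/SUBDAG-AbsTopIII-Thm19.md`, rows Thm19.d.r9 / r10; cell abc-iut, abc-iut-L4-lead RULINGS #3f (3)
2026-08-26T02:26:22Z).  Relative to a model `M : IntrinsicKummerModel` and a directed system `S` of
NF-complements over a (d)-input `Z`, this file PROVES — from abc-iut-L4-t1's NAMED FACTS `Prop_1_8_i`,
`Prop_1_8_ii`, `Prop_1_6_iii_units`, `Prop_1_6_iii_ker` and `Rmk_1_5_4_i` ("sub-`p`-adic ⟹ Kummer-faithful")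
consumed BY NAME —

* the LEVELWISE content of "via [...] Proposition 1.8, (i), (ii)": a class of level `i` satisfies the
  printed (i)-criterion (`IsNonconstNFClass`) iff it is the Kummer class of a nonconstant NF-rational
  regular unit of `V_i` (`isNonconstNFClass_iff`); it satisfies the (ii)-criterion (`IsNFConstClass`) iff
  `V_i` carries a nonconstant NF-rational regular unit and the class is the Kummer class of an NF-constant
  (`isNFConstClass_iff`; the Galois-class clause is automatic for constants,
  `kummer_const_mem_galoisClasses`, from Prop. 1.6 (iii));
* the inclusions `constantPart S ⊆ nfConstantImage S` (no further input) and
  `functionFieldPart S ⊆ nfRationalImage S` (one interface identification as an explicit binder: Def. 1.7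
  (ii) "NF-constants" are NF-rational as constant functions — `CurveModel` types `IsNFConstant` (on `k`)
  and `IsNFRational` (on `K_U`) as unrelated primitives), and the converse inclusions at levels carrying a
  nonconstant NF-rational unit;
* the set EQUALITIES `functionFieldPart S = nfRationalImage S`, `constantPart S = nfConstantImage S` (the
  first conjuncts of `Thm19d_functionField` / `Thm19d_constants`) under EXPLICIT BINDERS for the interface
  laws the tree's `IntrinsicKummerModel` does not carry (cell GAP-LEDGER rows G-w5d213-1 / G-w5d213-2, exact
  statements there): the unit restrictions along the transitions with the NATURALITY of the Kummer maps
  (a constant regular unit of a level WITHOUT nonconstant NF-rational units is certified by Prop. 1.8 (ii)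
  only at a deeper level), their compatibility with constants, and the EVENTUAL existence of nonconstant
  NF-rational units along the system (true at the intended model by the cofinality clauses of `S` and the
  existence of one nonconstant rational function on `Z_NF`; not derivable from the interface);
The second conjuncts of the named statements (the EMBEDDINGS "`K_{Z_NF}^× ↪ lim`", "`k̄_NF^× ↪ lim`" with
these parts as images) and the closers `thm19d_functionField_of_…` / `thm19d_constants_of_…` are the sibling
proof-only file `Thm19KummerContainerEmbeddingProofs.lean` (they need, in addition, `Thm19d_inj` and the
tower of base fields / function fields of the levels — `M.NFFunctionField Z` is an abstract field of
`CurveModel` with no map to the function fields of the levels: interface identification, GAP row G-w5d213-2).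

No definition, no new named fact; every non-fact input is an explicit hypothesis in Lean-signature form.
HONEST FRAMING: typed ≠ proved for the binders; nothing here bears on [IUTchIII] Cor. 3.12.
-/

noncomputable section

open CategoryTheory
open scoped Classical

namespace Literature.AnabelianGeometry.AbsoluteAnabelian.AbsTopIII

universe u

namespace IntrinsicKummerModel

variable (M : IntrinsicKummerModel.{u}) {Z : M.Curve} {ι : Type u} [Preorder ι]
  (S : CurveModel.NFComplementSystem M.toCurveModel Z ι)

/-! ### The printed hypotheses of Prop. 1.8 hold at every level of the system -/

/-- Every base change `Z ×_{k_Z} k′_i` of the (d)-input `Z` has genus `≥ 2` ("`Y` is of genus `≥ 2`",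
Thm. 1.9 (b) p. 37; `genus_eq`). [cite: MochizukiAbsTopIII2015, Thm 1.9 (b) p.37] -/
theorem two_le_genus_Zb (hZ : M.IsThm19dInput Z) (i : ι) : 2 ≤ M.genus (S.Zb i) := by
  have h := S.genus_eq i
  have h2 := hZ.two_le_genus
  change 2 ≤ M.toCurveModel.genus (S.Zb i)
  rw [h]
  exact h2

/-- The base field `k′_i` of every level is Kummer-faithful ("sub-`p`-adic ⟹ Kummer-faithful",
Rmk. 1.5.4 (i), consumed BY NAME as `Rmk_1_5_4_i`). [cite: MochizukiAbsTopIII2015, Rmk 1.5.4 (i) p.33] -/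
theorem isKummerFaithful_level (h154 : Rmk_1_5_4_i.{u}) (i : ι) : IsKummerFaithful (M.base (S.V i)) :=
  h154 _ (S.isSubpadic i)

/-! ### Levelwise: the criteria of Prop. 1.8 (i), (ii) versus Kummer classes -/

/-- **Prop. 1.8 (i) at level `i`** (BY NAME): a class satisfies the printed (i)-criterion iff it is the
Kummer class of a nonconstant NF-rational regular unit of `V_i`.
[cite: MochizukiAbsTopIII2015, Prop 1.8 (i) p.36] -/
theorem isNonconstNFClass_iff (h18i : M.Prop_1_8_i) (h154 : Rmk_1_5_4_i.{u})
    (hZ : M.IsThm19dInput Z) (i : ι) (η : cyclotomeModH1 (M.res (S.isOpen i)) ZHatCoeff.{u}) :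
    M.IsNonconstNFClass S i η ↔
      ∃ f : M.regularUnits (S.V i),
        M.IsNFRational (S.V i) ((f : (M.FunctionField (S.V i))ˣ) : M.FunctionField (S.V i)) ∧
          ¬ M.IsConstantUnit (f : (M.FunctionField (S.V i))ˣ) ∧
            Multiplicative.toAdd (M.kummerMap (S.isOpen i) (S.isProper i) f) = η := by
  have key := h18i (S.V i) (S.Zb i) (S.isOpen i) (S.isProper i) (S.isScheme i).1 (S.isScheme i).2
    (M.two_le_genus_Zb S hZ i) (M.isKummerFaithful_level S h154 i) (S.cuspsRational i) (S.isNFCurve i)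
  constructor
  · rintro ⟨hPU, hrest⟩
    exact (key η hPU).2 hrest
  · rintro ⟨f, hf, hnc, rfl⟩
    exact ⟨M.kummer_mem_PU _ _ f, (key _ (M.kummer_mem_PU _ _ f)).1 ⟨f, hf, hnc, rfl⟩⟩

/-- The regular unit defined by a constant `c ∈ k′^×` IS a constant unit (`IsConstantUnit`).
[cite: MochizukiAbsTopIII2015, Prop 1.6 (iii) p.35] -/
theorem isConstantUnit_const {U : M.Curve} (c : (M.base U)ˣ)
    (hc : Units.map (algebraMap (M.base U) (M.FunctionField U) : _ →* _) c ∈ M.regularUnits U) :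
    M.IsConstantUnit ((⟨_, hc⟩ : M.regularUnits U) : (M.FunctionField U)ˣ) :=
  ⟨c, rfl⟩

/-- **The Kummer class of a constant is a Galois class** (`κ(c) ∈ H¹(G_k, M_X) = Ker res_Δ`): Prop. 1.6
(iii) BY NAME in its two typed halves — a constant unit has vanishing restriction to every cuspidal inertia
group (`Prop_1_6_iii_units`), and such classes are exactly the Galois classes (`Prop_1_6_iii_ker`).
[cite: MochizukiAbsTopIII2015, Prop 1.6 (iii) p.35] -/
theorem kummer_const_mem_galoisClasses (h16u : M.Prop_1_6_iii_units) (h16k : M.Prop_1_6_iii_ker)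
    (h154 : Rmk_1_5_4_i.{u}) (hZ : M.IsThm19dInput Z) (i : ι) (c : (M.base (S.V i))ˣ)
    (hc : Units.map (algebraMap (M.base (S.V i)) (M.FunctionField (S.V i)) : _ →* _) c ∈
      M.regularUnits (S.V i)) :
    Multiplicative.toAdd (M.kummerMap (S.isOpen i) (S.isProper i) ⟨_, hc⟩) ∈
      M.galoisClasses (S.isOpen i) := by
  rw [M.kummer_mem_galoisClasses_iff h16k (S.isOpen i) (S.isProper i) (S.isScheme i).1 (S.isScheme i).2
    (M.two_le_genus_Zb S hZ i) (M.isKummerFaithful_level S h154 i) (S.cuspsRational i)]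
  exact (h16u (S.V i) (S.Zb i) (S.isOpen i) (S.isProper i) (S.isScheme i).1 (S.isScheme i).2
    (M.two_le_genus_Zb S hZ i) (M.isKummerFaithful_level S h154 i) (S.cuspsRational i) ⟨_, hc⟩).2
    (M.isConstantUnit_const c hc)

/-- **Prop. 1.8 (ii) at level `i`** (BY NAME, with Prop. 1.8 (i) for the auxiliary nonconstant class and
Prop. 1.6 (iii) for the Galois clause): a class satisfies the printed (ii)-criterion iff the level carries a
nonconstant NF-rational regular unit (the standing hypothesis of Prop. 1.8 (ii)) and the class is the
Kummer class of an NF-constant. [cite: MochizukiAbsTopIII2015, Prop 1.8 (ii) p.36] -/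
theorem isNFConstClass_iff (h18i : M.Prop_1_8_i) (h18ii : M.Prop_1_8_ii) (h16u : M.Prop_1_6_iii_units)
    (h16k : M.Prop_1_6_iii_ker) (h154 : Rmk_1_5_4_i.{u}) (hZ : M.IsThm19dInput Z) (i : ι)
    (η : cyclotomeModH1 (M.res (S.isOpen i)) ZHatCoeff.{u}) :
    M.IsNFConstClass S i η ↔
      (∃ g : M.regularUnits (S.V i),
          M.IsNFRational (S.V i) ((g : (M.FunctionField (S.V i))ˣ) : M.FunctionField (S.V i)) ∧
            ¬ M.IsConstantUnit (g : (M.FunctionField (S.V i))ˣ)) ∧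
        ∃ (c : (M.base (S.V i))ˣ)
          (hc : Units.map (algebraMap (M.base (S.V i)) (M.FunctionField (S.V i)) : _ →* _) c ∈
            M.regularUnits (S.V i)),
          M.IsNFConstant (S.V i) (c : M.base (S.V i)) ∧
            Multiplicative.toAdd (M.kummerMap (S.isOpen i) (S.isProper i) ⟨_, hc⟩) = η := by
  have key := h18ii (S.V i) (S.Zb i) (S.isOpen i) (S.isProper i) (S.isScheme i).1 (S.isScheme i).2
    (M.two_le_genus_Zb S hZ i) (M.isKummerFaithful_level S h154 i) (S.cuspsRational i) (S.isNFCurve i)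
  constructor
  · rintro ⟨hPU, hgal, θ, y, hθ, hy, hres⟩
    obtain ⟨f, hf, hnc, rfl⟩ := (M.isNonconstNFClass_iff S h18i h154 hZ i θ).1 hθ
    have hrich : ∃ g : M.regularUnits (S.V i),
        M.IsNFRational (S.V i) ((g : (M.FunctionField (S.V i))ˣ) : M.FunctionField (S.V i)) ∧
          ¬ M.IsConstantUnit (g : (M.FunctionField (S.V i))ˣ) := ⟨f, hf, hnc⟩
    exact ⟨hrich, ((key hrich) η hPU hgal).2 ⟨f, y, hf, hnc, hy, hres⟩⟩
  · rintro ⟨hrich, c, hc, hcNF, rfl⟩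
    have hPU := M.kummer_mem_PU (S.isOpen i) (S.isProper i) ⟨_, hc⟩
    have hgal := M.kummer_const_mem_galoisClasses S h16u h16k h154 hZ i c hc
    obtain ⟨f, y, hf, hnc, hy, hres⟩ := ((key hrich) _ hPU hgal).1 ⟨c, hc, hcNF, rfl⟩
    exact ⟨hPU, hgal, _, y, (M.isNonconstNFClass_iff S h18i h154 hZ i _).2 ⟨f, hf, hnc, rfl⟩, hy, hres⟩

/-! ### The group-theoretic parts lie inside the model images (no interface law needed) -/

/-- **`"k̄_NF^×" ⊆` the Kummer classes of NF-constants**: every class of the container certified as an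
NF-constant by the criterion of Prop. 1.8 (ii) IS the image of the Kummer class of an NF-constant of some
level (Prop. 1.8 (i)(ii), Prop. 1.6 (iii), Rmk. 1.5.4 (i) BY NAME; no interface law needed).
[cite: MochizukiAbsTopIII2015, Thm 1.9 (d) p.38] -/
theorem constantPart_subset_nfConstantImage (h18i : M.Prop_1_8_i) (h18ii : M.Prop_1_8_ii)
    (h16u : M.Prop_1_6_iii_units) (h16k : M.Prop_1_6_iii_ker) (h154 : Rmk_1_5_4_i.{u})
    (hZ : M.IsThm19dInput Z) : M.constantPart S ⊆ M.nfConstantImage S := by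
  rintro ξ ⟨i, η, hη, rfl⟩
  obtain ⟨-, c, hc, hcNF, hcη⟩ := (M.isNFConstClass_iff S h18i h18ii h16u h16k h154 hZ i η).1 hη
  refine ⟨i, c, hc, hcNF, ?_⟩
  rw [kummerToContainer_apply, kummerLevel_apply, kummerAddHom_apply, hcη]

/-- The image in the container of the Kummer class of a NONCONSTANT NF-rational regular unit of a level lies
in "`K_{Z_NF}^×`" (certified by Prop. 1.8 (i) at that level). [cite: MochizukiAbsTopIII2015, Thm 1.9 (d) p.38] -/
theorem kummerToContainer_mem_functionFieldPart (h18i : M.Prop_1_8_i) (h154 : Rmk_1_5_4_i.{u})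
    (hZ : M.IsThm19dInput Z) (i : ι) (f : M.regularUnits (S.V i))
    (hf : M.IsNFRational (S.V i) ((f : (M.FunctionField (S.V i))ˣ) : M.FunctionField (S.V i)))
    (hnc : ¬ M.IsConstantUnit (f : (M.FunctionField (S.V i))ˣ)) :
    M.kummerToContainer S i (Additive.ofMul f) ∈ M.functionFieldPart S :=
  ⟨i, _, Or.inl ((M.isNonconstNFClass_iff S h18i h154 hZ i _).2 ⟨f, hf, hnc, rfl⟩), rfl⟩

/-- The image in the container of the Kummer class of an NF-constant of a level CARRYING a nonconstant
NF-rational regular unit lies in "`k̄_NF^×`" (certified by Prop. 1.8 (ii) at that level).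
[cite: MochizukiAbsTopIII2015, Thm 1.9 (d) p.38] -/
theorem kummerToContainer_const_mem_constantPart (h18i : M.Prop_1_8_i) (h18ii : M.Prop_1_8_ii)
    (h16u : M.Prop_1_6_iii_units) (h16k : M.Prop_1_6_iii_ker) (h154 : Rmk_1_5_4_i.{u})
    (hZ : M.IsThm19dInput Z) (i : ι)
    (hrich : ∃ g : M.regularUnits (S.V i),
      M.IsNFRational (S.V i) ((g : (M.FunctionField (S.V i))ˣ) : M.FunctionField (S.V i)) ∧
        ¬ M.IsConstantUnit (g : (M.FunctionField (S.V i))ˣ))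
    (c : (M.base (S.V i))ˣ)
    (hc : Units.map (algebraMap (M.base (S.V i)) (M.FunctionField (S.V i)) : _ →* _) c ∈
      M.regularUnits (S.V i))
    (hcNF : M.IsNFConstant (S.V i) (c : M.base (S.V i))) :
    M.kummerToContainer S i (Additive.ofMul ⟨_, hc⟩) ∈ M.constantPart S :=
  ⟨i, _, (M.isNFConstClass_iff S h18i h18ii h16u h16k h154 hZ i _).2 ⟨hrich, c, hc, hcNF, rfl⟩, rfl⟩

/-- **`"K_{Z_NF}^×" ⊆` the Kummer classes of NF-rational regular units**, given the Def.-1.7 (ii)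
identification "an NF-constant is NF-rational as a (constant) function" as an explicit binder `hconst`
(interface identification: `CurveModel.IsNFConstant` on `k` and `CurveModel.IsNFRational` on `K_U` are
unrelated primitives; cell GAP-LEDGER G-w5d213-2 (a)). [cite: MochizukiAbsTopIII2015, Thm 1.9 (d) p.38] -/
theorem functionFieldPart_subset_nfRationalImage (h18i : M.Prop_1_8_i) (h18ii : M.Prop_1_8_ii)
    (h16u : M.Prop_1_6_iii_units) (h16k : M.Prop_1_6_iii_ker) (h154 : Rmk_1_5_4_i.{u})
    (hZ : M.IsThm19dInput Z)
    (hconst : ∀ (i : ι) (c : (M.base (S.V i))ˣ), M.IsNFConstant (S.V i) (c : M.base (S.V i)) →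
      M.IsNFRational (S.V i) (algebraMap (M.base (S.V i)) (M.FunctionField (S.V i)) c)) :
    M.functionFieldPart S ⊆ M.nfRationalImage S := by
  rintro ξ ⟨i, η, hη, rfl⟩
  rcases hη with hη | hη
  · obtain ⟨f, hf, -, hfη⟩ := (M.isNonconstNFClass_iff S h18i h154 hZ i η).1 hη
    refine ⟨i, f, hf, ?_⟩
    rw [kummerToContainer_apply, kummerLevel_apply, kummerAddHom_apply, hfη]
  · obtain ⟨-, c, hc, hcNF, hcη⟩ := (M.isNFConstClass_iff S h18i h18ii h16u h16k h154 hZ i η).1 hη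
    refine ⟨i, ⟨_, hc⟩, hconst i c hcNF, ?_⟩
    rw [kummerToContainer_apply, kummerLevel_apply, kummerAddHom_apply, hcη]

/-! ### Under the interface laws (explicit binders): the set equalities of (d) -/

section Laws

variable {M S}

/-- NATURALITY of the Kummer maps along the transitions (explicit binder `hnat` over unit restrictions
`ρ`; cell GAP-LEDGER G-w5d213-1) in the container: the class of `f|_{V_j}` equals the class of `f`.
[cite: MochizukiAbsTopIII2015, Thm 1.9 (d) p.38] -/
theorem kummerToContainer_restrict
    (ρ : ∀ ⦃i j : ι⦄, i ≤ j → (Additive (M.regularUnits (S.V i)) →+ Additive (M.regularUnits (S.V j))))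
    (hnat : ∀ ⦃i j : ι⦄ (h : i ≤ j) (f : Additive (M.regularUnits (S.V i))),
      S.transition i j h (M.kummerLevel S i f) = M.kummerLevel S j (ρ h f))
    {i j : ι} (h : i ≤ j) (f : Additive (M.regularUnits (S.V i))) :
    M.kummerToContainer S j (ρ h f) = M.kummerToContainer S i f := by
  rw [kummerToContainer_apply, kummerToContainer_apply, ← hnat h f, S.toContainer_transition h]

variable (M S)

/-- **The Kummer classes of NF-constants `⊆ "k̄_NF^×"`** under the interface laws: the unit restrictions
`ρ` with the naturality of the Kummer maps (`hnat`), their compatibility with NF-constants (`hρconst`), and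
the EVENTUAL existence of nonconstant NF-rational regular units along the system (`hrich` — the standing
hypothesis of Prop. 1.8 (ii), met cofinally at the intended model); Prop. 1.8 (i)(ii), Prop. 1.6 (iii),
Rmk. 1.5.4 (i) BY NAME.  A constant of a level without nonconstant NF-rational units is certified by the
(ii)-criterion at a deeper level. [cite: MochizukiAbsTopIII2015, Thm 1.9 (d) p.38] -/
theorem nfConstantImage_subset_constantPart (h18i : M.Prop_1_8_i) (h18ii : M.Prop_1_8_ii)
    (h16u : M.Prop_1_6_iii_units) (h16k : M.Prop_1_6_iii_ker) (h154 : Rmk_1_5_4_i.{u})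
    (hZ : M.IsThm19dInput Z)
    (ρ : ∀ ⦃i j : ι⦄, i ≤ j → (Additive (M.regularUnits (S.V i)) →+ Additive (M.regularUnits (S.V j))))
    (hnat : ∀ ⦃i j : ι⦄ (h : i ≤ j) (f : Additive (M.regularUnits (S.V i))),
      S.transition i j h (M.kummerLevel S i f) = M.kummerLevel S j (ρ h f))
    (hρconst : ∀ ⦃i j : ι⦄ (h : i ≤ j) (c : (M.base (S.V i))ˣ)
      (hc : Units.map (algebraMap (M.base (S.V i)) (M.FunctionField (S.V i)) : _ →* _) c ∈
        M.regularUnits (S.V i)), M.IsNFConstant (S.V i) (c : M.base (S.V i)) →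
      ∃ (c' : (M.base (S.V j))ˣ)
        (hc' : Units.map (algebraMap (M.base (S.V j)) (M.FunctionField (S.V j)) : _ →* _) c' ∈
          M.regularUnits (S.V j)),
        M.IsNFConstant (S.V j) (c' : M.base (S.V j)) ∧
          ρ h (Additive.ofMul ⟨_, hc⟩) = Additive.ofMul ⟨_, hc'⟩)
    (hrich : ∀ i : ι, ∃ (j : ι) (_ : i ≤ j) (g : M.regularUnits (S.V j)),
      M.IsNFRational (S.V j) ((g : (M.FunctionField (S.V j))ˣ) : M.FunctionField (S.V j)) ∧
        ¬ M.IsConstantUnit (g : (M.FunctionField (S.V j))ˣ)) :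
    M.nfConstantImage S ⊆ M.constantPart S := by
  rintro ξ ⟨i, c, hc, hcNF, rfl⟩
  obtain ⟨j, hij, g, hg, hgnc⟩ := hrich i
  obtain ⟨c', hc', hc'NF, hρ⟩ := hρconst hij c hc hcNF
  rw [← kummerToContainer_restrict ρ hnat hij (Additive.ofMul ⟨_, hc⟩), hρ]
  exact M.kummerToContainer_const_mem_constantPart S h18i h18ii h16u h16k h154 hZ j ⟨g, hg, hgnc⟩
    c' hc' hc'NF

/-- A constant unit `f` of a level is the regular unit of a unit `c` of the base field.
[cite: MochizukiAbsTopIII2015, Prop 1.6 (iii) p.35] -/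
theorem exists_const_of_isConstantUnit {U : M.Curve} (f : M.regularUnits U)
    (hf : M.IsConstantUnit (f : (M.FunctionField U)ˣ)) :
    ∃ (c : (M.base U)ˣ)
      (hc : Units.map (algebraMap (M.base U) (M.FunctionField U) : _ →* _) c ∈ M.regularUnits U),
      (⟨_, hc⟩ : M.regularUnits U) = f ∧
        algebraMap (M.base U) (M.FunctionField U) c =
          ((f : (M.FunctionField U)ˣ) : M.FunctionField U) := by
  obtain ⟨c₀, hc₀⟩ := hf
  have hc₀0 : c₀ ≠ 0 := by
    rintro rfl
    exact ((f : (M.FunctionField U)ˣ)).ne_zero (by rw [← hc₀, map_zero])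
  have hmap : Units.map (algebraMap (M.base U) (M.FunctionField U) : _ →* _) (Units.mk0 c₀ hc₀0) =
      (f : (M.FunctionField U)ˣ) :=
    Units.ext (by simp [hc₀])
  refine ⟨Units.mk0 c₀ hc₀0, hmap ▸ f.2, Subtype.ext hmap, ?_⟩
  simp [hc₀]

/-- **The Kummer classes of NF-rational regular units `⊆ "K_{Z_NF}^×"`** under the interface laws of
`nfConstantImage_subset_constantPart` and the Def.-1.7 (ii) identification `hconst` (an NF-rational
CONSTANT function is an NF-constant); Prop. 1.8 (i)(ii), Prop. 1.6 (iii), Rmk. 1.5.4 (i) BY NAME.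
[cite: MochizukiAbsTopIII2015, Thm 1.9 (d) p.38] -/
theorem nfRationalImage_subset_functionFieldPart (h18i : M.Prop_1_8_i) (h18ii : M.Prop_1_8_ii)
    (h16u : M.Prop_1_6_iii_units) (h16k : M.Prop_1_6_iii_ker) (h154 : Rmk_1_5_4_i.{u})
    (hZ : M.IsThm19dInput Z)
    (ρ : ∀ ⦃i j : ι⦄, i ≤ j → (Additive (M.regularUnits (S.V i)) →+ Additive (M.regularUnits (S.V j))))
    (hnat : ∀ ⦃i j : ι⦄ (h : i ≤ j) (f : Additive (M.regularUnits (S.V i))),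
      S.transition i j h (M.kummerLevel S i f) = M.kummerLevel S j (ρ h f))
    (hρconst : ∀ ⦃i j : ι⦄ (h : i ≤ j) (c : (M.base (S.V i))ˣ)
      (hc : Units.map (algebraMap (M.base (S.V i)) (M.FunctionField (S.V i)) : _ →* _) c ∈
        M.regularUnits (S.V i)), M.IsNFConstant (S.V i) (c : M.base (S.V i)) →
      ∃ (c' : (M.base (S.V j))ˣ)
        (hc' : Units.map (algebraMap (M.base (S.V j)) (M.FunctionField (S.V j)) : _ →* _) c' ∈
          M.regularUnits (S.V j)),
        M.IsNFConstant (S.V j) (c' : M.base (S.V j)) ∧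
          ρ h (Additive.ofMul ⟨_, hc⟩) = Additive.ofMul ⟨_, hc'⟩)
    (hrich : ∀ i : ι, ∃ (j : ι) (_ : i ≤ j) (g : M.regularUnits (S.V j)),
      M.IsNFRational (S.V j) ((g : (M.FunctionField (S.V j))ˣ) : M.FunctionField (S.V j)) ∧
        ¬ M.IsConstantUnit (g : (M.FunctionField (S.V j))ˣ))
    (hconst : ∀ (i : ι) (c : (M.base (S.V i))ˣ), M.IsNFConstant (S.V i) (c : M.base (S.V i)) ↔
      M.IsNFRational (S.V i) (algebraMap (M.base (S.V i)) (M.FunctionField (S.V i)) c)) :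
    M.nfRationalImage S ⊆ M.functionFieldPart S := by
  rintro ξ ⟨i, f, hf, rfl⟩
  by_cases hcu : M.IsConstantUnit (f : (M.FunctionField (S.V i))ˣ)
  · obtain ⟨c, hc, hcf, hval⟩ := M.exists_const_of_isConstantUnit f hcu
    have hcNF : M.IsNFConstant (S.V i) (c : M.base (S.V i)) := (hconst i c).2 (by rw [hval]; exact hf)
    rw [← hcf]
    exact M.constantPart_subset_functionFieldPart S
      (M.nfConstantImage_subset_constantPart S h18i h18ii h16u h16k h154 hZ ρ hnat hρconst hrich
        ⟨i, c, hc, hcNF, rfl⟩)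
  · exact M.kummerToContainer_mem_functionFieldPart S h18i h154 hZ i f hf hcu

/-- **Thm. 1.9 (d), "`k̄_NF^×`", SET HALF** (the first conjunct of `Thm19d_constants`): under the
interface laws, the part of the container cut out by the criterion of Prop. 1.8 (ii) EQUALS the set of
images of Kummer classes of NF-constants of the levels; Prop. 1.8 (i)(ii), Prop. 1.6 (iii), Rmk. 1.5.4 (i)
BY NAME. [cite: MochizukiAbsTopIII2015, Thm 1.9 (d) p.38] -/
theorem constantPart_eq_nfConstantImage (h18i : M.Prop_1_8_i) (h18ii : M.Prop_1_8_ii)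
    (h16u : M.Prop_1_6_iii_units) (h16k : M.Prop_1_6_iii_ker) (h154 : Rmk_1_5_4_i.{u})
    (hZ : M.IsThm19dInput Z)
    (ρ : ∀ ⦃i j : ι⦄, i ≤ j → (Additive (M.regularUnits (S.V i)) →+ Additive (M.regularUnits (S.V j))))
    (hnat : ∀ ⦃i j : ι⦄ (h : i ≤ j) (f : Additive (M.regularUnits (S.V i))),
      S.transition i j h (M.kummerLevel S i f) = M.kummerLevel S j (ρ h f))
    (hρconst : ∀ ⦃i j : ι⦄ (h : i ≤ j) (c : (M.base (S.V i))ˣ)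
      (hc : Units.map (algebraMap (M.base (S.V i)) (M.FunctionField (S.V i)) : _ →* _) c ∈
        M.regularUnits (S.V i)), M.IsNFConstant (S.V i) (c : M.base (S.V i)) →
      ∃ (c' : (M.base (S.V j))ˣ)
        (hc' : Units.map (algebraMap (M.base (S.V j)) (M.FunctionField (S.V j)) : _ →* _) c' ∈
          M.regularUnits (S.V j)),
        M.IsNFConstant (S.V j) (c' : M.base (S.V j)) ∧
          ρ h (Additive.ofMul ⟨_, hc⟩) = Additive.ofMul ⟨_, hc'⟩)
    (hrich : ∀ i : ι, ∃ (j : ι) (_ : i ≤ j) (g : M.regularUnits (S.V j)),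
      M.IsNFRational (S.V j) ((g : (M.FunctionField (S.V j))ˣ) : M.FunctionField (S.V j)) ∧
        ¬ M.IsConstantUnit (g : (M.FunctionField (S.V j))ˣ)) :
    M.constantPart S = M.nfConstantImage S :=
  Set.Subset.antisymm (M.constantPart_subset_nfConstantImage S h18i h18ii h16u h16k h154 hZ)
    (M.nfConstantImage_subset_constantPart S h18i h18ii h16u h16k h154 hZ ρ hnat hρconst hrich)

/-- **Thm. 1.9 (d), "`K_{Z_NF}^×`", SET HALF** (the first conjunct of `Thm19d_functionField`): under the
interface laws and the Def.-1.7 (ii) identification, the part of the container cut out by the criteria of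
Prop. 1.8 (i), (ii) EQUALS the set of images of Kummer classes of NF-rational regular units of the levels;
Prop. 1.8 (i)(ii), Prop. 1.6 (iii), Rmk. 1.5.4 (i) BY NAME. [cite: MochizukiAbsTopIII2015, Thm 1.9 (d) p.38] -/
theorem functionFieldPart_eq_nfRationalImage (h18i : M.Prop_1_8_i) (h18ii : M.Prop_1_8_ii)
    (h16u : M.Prop_1_6_iii_units) (h16k : M.Prop_1_6_iii_ker) (h154 : Rmk_1_5_4_i.{u})
    (hZ : M.IsThm19dInput Z)
    (ρ : ∀ ⦃i j : ι⦄, i ≤ j → (Additive (M.regularUnits (S.V i)) →+ Additive (M.regularUnits (S.V j))))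
    (hnat : ∀ ⦃i j : ι⦄ (h : i ≤ j) (f : Additive (M.regularUnits (S.V i))),
      S.transition i j h (M.kummerLevel S i f) = M.kummerLevel S j (ρ h f))
    (hρconst : ∀ ⦃i j : ι⦄ (h : i ≤ j) (c : (M.base (S.V i))ˣ)
      (hc : Units.map (algebraMap (M.base (S.V i)) (M.FunctionField (S.V i)) : _ →* _) c ∈
        M.regularUnits (S.V i)), M.IsNFConstant (S.V i) (c : M.base (S.V i)) →
      ∃ (c' : (M.base (S.V j))ˣ)
        (hc' : Units.map (algebraMap (M.base (S.V j)) (M.FunctionField (S.V j)) : _ →* _) c' ∈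
          M.regularUnits (S.V j)),
        M.IsNFConstant (S.V j) (c' : M.base (S.V j)) ∧
          ρ h (Additive.ofMul ⟨_, hc⟩) = Additive.ofMul ⟨_, hc'⟩)
    (hrich : ∀ i : ι, ∃ (j : ι) (_ : i ≤ j) (g : M.regularUnits (S.V j)),
      M.IsNFRational (S.V j) ((g : (M.FunctionField (S.V j))ˣ) : M.FunctionField (S.V j)) ∧
        ¬ M.IsConstantUnit (g : (M.FunctionField (S.V j))ˣ))
    (hconst : ∀ (i : ι) (c : (M.base (S.V i))ˣ), M.IsNFConstant (S.V i) (c : M.base (S.V i)) ↔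
      M.IsNFRational (S.V i) (algebraMap (M.base (S.V i)) (M.FunctionField (S.V i)) c)) :
    M.functionFieldPart S = M.nfRationalImage S :=
  Set.Subset.antisymm
    (M.functionFieldPart_subset_nfRationalImage S h18i h18ii h16u h16k h154 hZ
      fun i c h => (hconst i c).1 h)
    (M.nfRationalImage_subset_functionFieldPart S h18i h18ii h16u h16k h154 hZ ρ hnat hρconst hrich
      hconst)

end Laws

end IntrinsicKummerModel

end Literature.AnabelianGeometry.AbsoluteAnabelian.AbsTopIII
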